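import Mathlib
import Summits.MatrixMultiplication.MatrixMultiplication.Theorems.SnSubsetDichotomyPolynomialSlackAtomBasicFacts

/-!
# Atom basic facts with a column mask (3/4 step)

Crux `Summit.MatrixMultiplication.MatrixMultiplication.Theses.SnSubsetDichotomy.PolynomialSlack`
(item `stmt-MatrixMultiplication-8306`), level-one programme, line transport-split-hull (lead c10).
MASKED copy of c9's `atom_basic_facts` (`…AtomBasicFacts`): at a hub position `k` the S-level blocks
are the dyadic level blocks of the heavy row `dC(k,·)` with a set `Qm` of S-positions REMOVED
(`i ∉ Qm ∧ θC ≤ dC k i ∧ ⌊log₂(1/dC k i)⌋ = b`); the T-levels are unchanged.  In the 3/4 step the hub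
rows of the sparse profile are analysed with the hub COLUMNS `Qm` masked out (those cells are analysed at
the columns, for the reversed triple), so that the row blocks avoid the hub values as the mixed entropy
certificate requires.  Conclusions (1)–(8) are those of `atom_basic_facts` for the masked blocks (the
masked blocks are still pairwise disjoint, flat sub-blocks of the level blocks, so `hub_budget_facts`,
`level_sums_cmp`, `double_sum_eq_sum_atoms` apply as before); (9), (10) split the MASKED row sums
`Σ_{i ∉ Qm} pC(k,i)` and `Σ_{i ∉ Qm} Σ_j dA pB pC` over the levels/atoms.
-/

namespace Summit.MatrixMultiplication.MatrixMultiplication.Theorems.PolynomialSlack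

open scoped BigOperators

set_option linter.dupNamespace false

/-! ## Kept masses on an arbitrary heavy block -/

/-- **Kept block masses versus block masses, arbitrary heavy block.** On any block `s` of heavy
cells (`θ ≤ d j` on `s`, `16/n ≤ θ`) the kept mass `Σ_s p = Σ_s (d - 1/n)` satisfies
`0 ≤ Σ_s p ≤ Σ_s d` and `15/16 · Σ_s d ≤ Σ_s p` (the block version of `level_sums_cmp`, used for
the masked level blocks). [folklore] -/
theorem heavyBlock_sums_cmp {n : ℕ} (hn : 0 < n) (d p : Fin n → ℝ) (θ : ℝ)
    (hθ : 16 / (n : ℝ) ≤ θ) (hp : ∀ j, p j = if θ ≤ d j then d j - 1 / n else 0)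
    (s : Finset (Fin n)) (hs : ∀ j ∈ s, θ ≤ d j) :
    0 ≤ ∑ j ∈ s, p j ∧ ∑ j ∈ s, p j ≤ ∑ j ∈ s, d j ∧ 15 / 16 * ∑ j ∈ s, d j ≤ ∑ j ∈ s, p j := by
  have hmem : ∀ j ∈ s, p j = d j - 1 / n ∧ 0 ≤ d j - 1 / n ∧ 15 / 16 * d j ≤ d j - 1 / n :=
    fun j hj => ⟨by rw [hp, if_pos (hs j hj)], heavy_kept_bounds hn θ (d j) hθ (hs j hj)⟩
  have h0 : (0 : ℝ) ≤ 1 / n := by positivity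
  refine ⟨Finset.sum_nonneg fun j hj => ?_, Finset.sum_le_sum fun j hj => ?_, ?_⟩
  · obtain ⟨e, h1, -⟩ := hmem j hj
    rw [e]
    exact h1
  · obtain ⟨e, -, -⟩ := hmem j hj
    rw [e]
    linarith
  · rw [Finset.mul_sum]
    refine Finset.sum_le_sum fun j hj => ?_
    obtain ⟨e, -, h2⟩ := hmem j hj
    rw [e]
    exact h2

/-! ## Masked heavy sums split over the masked levels -/

/-- **Masked sums of kept quantities split over the masked levels.** If `16/n ≤ θ`, `d ≤ 1` and
`g` vanishes off the heavy cells `{j : θ ≤ d j}`, then for any mask `Qm`,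
`Σ_{j ∉ Qm} g j = Σ_a Σ_{j ∉ Qm, j ∈ J_a} g j` over the `⌊log₂ n²⌋₊ + 1` level blocks `J_a` of
the heavy profile (the masked version of `sum_eq_sum_levels_of_vanish`). [folklore] -/
theorem sum_offMask_eq_sum_levels_of_vanish {n : ℕ} (hn : 1 ≤ n) (d : Fin n → ℝ) (θ : ℝ)
    (hθ : 16 / (n : ℝ) ≤ θ) (hd1 : ∀ j, d j ≤ 1) (Qm : Finset (Fin n)) (g : Fin n → ℝ)
    (hg : ∀ j, ¬θ ≤ d j → g j = 0) :
    ∑ j ∈ Finset.univ.filter (fun j => j ∉ Qm), g j =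
      ∑ a : Fin (⌊Real.logb 2 ((n : ℝ) ^ 2)⌋₊ + 1),
        ∑ j ∈ Finset.univ.filter
          (fun j => j ∉ Qm ∧ θ ≤ d j ∧ ⌊Real.logb 2 (1 / d j)⌋₊ = a.val), g j := by
  -- `Σ_{j ∉ Qm} g = Σ_j g'` with `g' = g · 1[· ∉ Qm]`, which still vanishes off the heavy cells
  rw [Finset.sum_filter, sum_eq_sum_levels_of_vanish hn d θ hθ hd1
    (fun j => if j ∉ Qm then g j else 0) fun j hj => by rw [hg j hj]; exact ite_self 0]
  refine Finset.sum_congr rfl fun a _ => ?_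
  -- push the indicator back into the level filter
  simp only [Finset.sum_filter]
  refine Finset.sum_congr rfl fun j _ => ?_
  by_cases h1 : j ∉ Qm
  · by_cases h2 : θ ≤ d j ∧ ⌊Real.logb 2 (1 / d j)⌋₊ = a.val
    · rw [if_pos h2, if_pos h1, if_pos ⟨h1, h2⟩]
    · rw [if_neg h2, if_neg fun h' => h2 h'.2]
  · have h3 : ¬(j ∉ Qm ∧ θ ≤ d j ∧ ⌊Real.logb 2 (1 / d j)⌋₊ = a.val) := fun h' => h1 h'.1
    rw [if_neg h1, ite_self, if_neg h3]

/-! ## The stub -/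

/-- **Atom basic facts, masked (HA0-m).** As `atom_basic_facts`, with the S-level blocks restricted to `i ∉ Qm`: (1)-(2) `0 ≤ σ ≤ σ'`, `15/16 σ' ≤ σ` (same for `ρ`); (3)-(6) hub masses nonnegative, row/column sums bounded by the block masses, the budget `Σ_P σ' + Σ_Q ρ' ≤ 1 + Σ_{P×Q} h`; (7) `Ψ ≥ 0`; (8)-(10) `Σ_j pB`, `Σ_{i ∉ Qm} pC`, `Σ_{i ∉ Qm} Σ_j dA pB pC` split over the levels / atoms. [folklore] -/
theorem atom_basic_facts_masked {n : ℕ} (hn : 2 ≤ n) {S T U : Finset (Equiv.Perm (Fin n))} (hS0 : S.Nonempty) (hT0 : T.Nonempty) (hU0 : U.Nonempty) (dA dB dC pB pC : Fin n → Fin n → ℝ) (hdA : ∀ i j, dA i j = (((S ×ˢ T).filter fun st => st.2 j = st.1 i).card : ℝ) / (S.card * T.card : ℕ)) (hdB : ∀ j k, dB j k = (((T ×ˢ U).filter fun tu => tu.2 k = tu.1 j).card : ℝ) / (T.card * U.card : ℕ)) (hdC : ∀ k i, dC k i = (((U ×ˢ S).filter fun us => us.2 i = us.1 k).card : ℝ)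 / (U.card * S.card : ℕ)) (θB θC : ℝ) (hθB : 16 / (n : ℝ) ≤ θB) (hθC : 16 / (n : ℝ) ≤ θC) (hpB : ∀ j k, pB j k = if θB ≤ dB j k then dB j k - 1 / n else 0) (hpC : ∀ k i, pC k i = if θC ≤ dC k i then dC k i - 1 / n else 0) (k : Fin n) (Qm : Finset (Fin n)) (σ σ' ρ ρ' : Fin (⌊Real.logb 2 ((n : ℝ) ^ 2)⌋₊ + 1) → ℝ) (hσ : ∀ a, σ a = ∑ j ∈ Finset.univ.filter (fun j => θB ≤ dB j k ∧ ⌊Real.logb 2 (1 / dB j k)⌋₊ = a.val), pB j k) (hσ' : ∀ a, σ' a = ∑ j ∈ Finset.univ.filter (fun j => θB ≤ dB j k ∧ ⌊Real.logb 2 (1 / dB j k)⌋₊ = a.val), dB j k) (hρ : ∀ b, ρ b = ∑ i ∈ Finset.univ.filter (fun i => i ∉ Qm ∧ θC ≤ dC k i ∧ ⌊Real.logb 2 (1 / dC k i)⌋₊ = b.val), pC k i) (hρ' : ∀ b, ρ' b = ∑ i ∈ Finset.univ.filter (fun i => i ∉ Qm ∧ θC ≤ dC k i ∧ ⌊Real.logb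 2 (1 / dC k i)⌋₊ = b.val), dC k i) (h Ψ : Fin (⌊Real.logb 2 ((n : ℝ) ^ 2)⌋₊ + 1) → Fin (⌊Real.logb 2 ((n : ℝ) ^ 2)⌋₊ + 1) → ℝ) (hh : ∀ a b, h a b = ∑ v : Fin n, ((U.filter fun u => u k = v).card : ℝ) / U.card * ((((T.filter fun t => t⁻¹ v ∈ Finset.univ.filter (fun j => θB ≤ dB j k ∧ ⌊Real.logb 2 (1 / dB j k)⌋₊ = a.val)).card : ℝ) / T.card) * (((S.filter fun s => s⁻¹ v ∈ Finset.univ.filter (fun i => i ∉ Qm ∧ θC ≤ dC k i ∧ ⌊Real.logb 2 (1 / dC k i)⌋₊ = b.val)).card : ℝ) / S.card))) (hΨ : ∀ a b, Ψ a b = ∑ i ∈ Finset.univ.filter (fun i => i ∉ Qm ∧ θC ≤ dC k i ∧ ⌊Real.logb 2 (1 / dC k i)⌋₊ = b.val), ∑ j ∈ Finset.univ.filter (fun j => θB ≤ dB j k ∧ ⌊Real.logb 2 (1 / dB j k)⌋₊ = a.val), dA i j * pB j k * pC k i) : (∀ a, 0 ≤ σ a ∧ σ a ≤ σ' a ∧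 15 / 16 * σ' a ≤ σ a) ∧ (∀ b, 0 ≤ ρ b ∧ ρ b ≤ ρ' b ∧ 15 / 16 * ρ' b ≤ ρ b) ∧ (∀ a b, 0 ≤ h a b) ∧ (∀ a, ∑ b, h a b ≤ σ' a) ∧ (∀ b, ∑ a, h a b ≤ ρ' b) ∧ (∀ (P Q : Finset (Fin (⌊Real.logb 2 ((n : ℝ) ^ 2)⌋₊ + 1))), ∑ a ∈ P, σ' a + ∑ b ∈ Q, ρ' b ≤ 1 + ∑ a ∈ P, ∑ b ∈ Q, h a b) ∧ (∀ a b, 0 ≤ Ψ a b) ∧ (∑ j : Fin n, pB j k = ∑ a, σ a) ∧ (∑ i ∈ Finset.univ.filter (fun i => i ∉ Qm), pC k i = ∑ b, ρ b) ∧ (∑ i ∈ Finset.univ.filter (fun i => i ∉ Qm), ∑ j : Fin n, dA i j * pB j k * pC k i = ∑ a, ∑ b, Ψ a b) := by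
  have hn0 : 0 < n := by omega
  have hn1 : 1 ≤ n := by omega
  have hdB1 : ∀ j, dB j k ≤ 1 := fun j => by rw [hdB]; exact pairDensity_le_one T U _
  have hdC1 : ∀ i, dC k i ≤ 1 := fun i => by rw [hdC]; exact pairDensity_le_one U S _
  have hpB0 : ∀ j, ¬θB ≤ dB j k → pB j k = 0 := fun j hj => by rw [hpB, if_neg hj]
  have hpC0 : ∀ i, ¬θC ≤ dC k i → pC k i = 0 := fun i hi => by rw [hpC, if_neg hi]
  -- conjuncts (3)-(6): hub-mass bookkeeping for the (disjoint) masked row blocks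
  obtain ⟨h3, h4, h5, h6⟩ := hub_budget_facts hS0 hT0 hU0 k
    (fun a => Finset.univ.filter (fun j => θB ≤ dB j k ∧ ⌊Real.logb 2 (1 / dB j k)⌋₊ = a.val))
    (fun b => Finset.univ.filter
      (fun i => i ∉ Qm ∧ θC ≤ dC k i ∧ ⌊Real.logb 2 (1 / dC k i)⌋₊ = b.val))
    (fun a a' hne => Finset.disjoint_filter.2 fun j _ hj hj' =>
      hne (Fin.ext (hj.2.symm.trans hj'.2)))
    (fun b b' hne => Finset.disjoint_filter.2 fun i _ hi hi' =>
      hne (Fin.ext (hi.2.2.symm.trans hi'.2.2)))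
    σ' ρ' h (fun a => by rw [hσ' a]; exact Finset.sum_congr rfl fun j _ => hdB j k)
    (fun b => by rw [hρ' b]; exact Finset.sum_congr rfl fun i _ => hdC k i) hh
  refine ⟨fun a => ?_, fun b => ?_, h3, h4, h5, h6, fun a b => ?_, ?_, ?_, ?_⟩
  · -- (1)
    rw [hσ a, hσ' a]
    exact level_sums_cmp hn0 (fun j => dB j k) (fun j => pB j k) θB hθB (fun j => hpB j k) a.val
  · -- (2): the masked level block is a block of heavy cells
    rw [hρ b, hρ' b]
    exact heavyBlock_sums_cmp hn0 (fun i => dC k i) (fun i => pC k i) θC hθC (fun i => hpC k i) _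
      fun i hi => (Finset.mem_filter.1 hi).2.2.1
  · -- (7)
    rw [hΨ]
    refine Finset.sum_nonneg fun i _ => Finset.sum_nonneg fun j _ => ?_
    have hA : 0 ≤ dA i j := by rw [hdA]; positivity
    exact mul_nonneg (mul_nonneg hA (kept_nonneg hn0 θB _ _ hθB (hpB j k)))
      (kept_nonneg hn0 θC _ _ hθC (hpC k i))
  · -- (8)
    simp only [hσ]
    exact sum_eq_sum_levels_of_vanish hn1 (fun j => dB j k) θB hθB hdB1 (fun j => pB j k) hpB0
  · -- (9)
    simp only [hρ]
    exact sum_offMask_eq_sum_levels_of_vanish hn1 (fun i => dC k i) θC hθC hdC1 Qm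
      (fun i => pC k i) hpC0
  · -- (10): split the masked outer sum over the masked levels of `dC(k,·)` ...
    simp only [hΨ]
    rw [sum_offMask_eq_sum_levels_of_vanish hn1 (fun i => dC k i) θC hθC hdC1 Qm
      (fun i => ∑ j, dA i j * pB j k * pC k i) fun i hi =>
        Finset.sum_eq_zero fun j _ => by rw [hpC0 i hi, mul_zero]]
    -- ... the inner sums over the levels of `dB(·,k)` ...
    have e1 : ∀ i, ∑ j, dA i j * pB j k * pC k i = ∑ a : Fin (⌊Real.logb 2 ((n : ℝ) ^ 2)⌋₊ + 1),
        ∑ j ∈ Finset.univ.filter (fun j => θB ≤ dB j k ∧ ⌊Real.logb 2 (1 / dB j k)⌋₊ = a.val),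
          dA i j * pB j k * pC k i :=
      fun i => sum_eq_sum_levels_of_vanish hn1 (fun j => dB j k) θB hθB hdB1
        (fun j => dA i j * pB j k * pC k i) fun j hj => by rw [hpB0 j hj, mul_zero, zero_mul]
    simp only [e1]
    -- ... and exchange the order of summation
    exact (Finset.sum_congr rfl fun b _ => Finset.sum_comm).trans Finset.sum_comm

end Summit.MatrixMultiplication.MatrixMultiplication.Theorems.PolynomialSlack
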